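import Mathlib
import HarnessLib
import Literature.MathematicalPhysics.QuantumManyBody.RelativeFisherInformation
import Summits.AtomisticToContinuum.BoseEinsteinCondensation.Theorems.BECConjugateDominationInfraredMinimumUncertaintyGroundStateRepresentation
import Summits.AtomisticToContinuum.BoseEinsteinCondensation.Theorems.BECFisherTransferTrialDriftFisherBoundWeakEulerLagrange

/-!
# Route `BECFisherTransfer` — support `TrialDriftFisherBound` (stmt-AtomisticToContinuum-14306):
# the ground-state representation for an integrable interaction

Helper file for `Summit.AtomisticToContinuum.BoseEinsteinCondensation.Theses.BECFisherTransfer.TrialDriftFisherBound`.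
The sibling file `…InfraredMinimumUncertaintyGroundStateRepresentation.lean` (route
`BECConjugateDomination`) proves the ground-state representation `⟨FΨ,(H - E₀)FΨ⟩ = ∫ |∇F|²|Ψ|²`
under a *bounded* periodised interaction. Here the same computation is run on top of the weak
Euler–Lagrange equation under an interaction *integrable on the fundamental cell*
(`…TrialDriftFisherBoundWeakEulerLagrange.lean`, `firstVariation_eq'`), and the conclusion is
rewritten over the landed definition `relativeFisherInformation` (`RelativeFisherInformation.lean`):

  `periodicEnergy v Φ = E₀^per + ¼ I_{cell^N}(P_Φ ‖ P_Ψ₀)`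

for any measurable `v ≥ 0`, a real positive `C¹` periodic minimiser `Ψ₀` with `E₀^per < ∞`, and any
real periodic trial state `Φ` (`periodicEnergy_eq_add_relativeFisherInformation`) — the identity of
item `GroundStateRepresentation` of this route under the finiteness guard [LSSY2005, (6.26)–(6.28);
AlbeverioHoeghkrohnStreit1977]: the energy excess of a positive trial state over the ground state
is a quarter of the relative Fisher information of `|Φ|²` with respect to `|Ψ₀|²`.

References: [LSSY2005] Lieb–Seiringer–Solovej–Yngvason 2005, (6.26)–(6.28), Ch. 7 (7.5);
[AlbeverioHoeghkrohnStreit1977]; [RezakhanlouVillani2008] Part I §1.3.1; [Fournais2020] (1.1)–(1.2).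
-/

noncomputable section

open MeasureTheory Filter Set
open scoped ENNReal NNReal Topology ComplexConjugate BigOperators

namespace Summit.AtomisticToContinuum.BoseEinsteinCondensation.Theorems

open Literature.MathematicalPhysics.QuantumManyBody.BoseGas

namespace TrialDriftFisher

open ImuWeakEulerLagrange (lintegral_nnnorm_sq_eq_ofReal)
open ImuGroundStateRepresentation (norm_sq_modulatedDeriv re_conj_modulatedTest_mul im_fderiv_eq_zero)

variable {N : ℕ} {L : ℝ} {v : ℝ → ℝ≥0∞}

/-! ### The ground-state representation -/

/-- **Core of the ground-state representation** under an interaction integrable on the cell. If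
`Ψ` is a real-valued `C¹` periodic state, `F` a `C¹` modulation, and the weak Euler–Lagrange identity
holds for the test function `η = conj(F) (F Ψ) = |F|² Ψ` with eigenvalue parameter `E`, then
`∫ (|∇(FΨ)|² + W |FΨ|²) - E ∫ |FΨ|² = ∫ |∇F|² |Ψ|²`. [cite: LSSY2005, (6.26)–(6.28)] -/
theorem form_modulated_sub_eq' (hvm : Measurable v)
    (hW : ∫⁻ X in cellN N L, periodicInteraction v L X ≠ ⊤) (Ψ : PeriodicTrialState N L)
    (hreal : ∀ X, Ψ.ψ X = (‖Ψ.ψ X‖ : ℂ)) {F : Config N → ℂ} (hF : ContDiff ℝ 1 F) (E : ℝ)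
    (hEL : (∫ X in cellN N L,
        ((∑ i : Fin N, ∑ k : Fin 3,
            (conj (fderiv ℝ (fun Y => conj (F Y) * (F Y * Ψ.ψ Y)) X
                (Pi.single i (EuclideanSpace.single k (1 : ℝ)))) *
              fderiv ℝ Ψ.ψ X (Pi.single i (EuclideanSpace.single k (1 : ℝ)))).re) +
          (periodicInteraction v L X).toReal * (conj (conj (F X) * (F X * Ψ.ψ X)) * Ψ.ψ X).re)) =
      E * ∫ X in cellN N L, (conj (conj (F X) * (F X * Ψ.ψ X)) * Ψ.ψ X).re) :
    (∫ X in cellN N L, ((∑ i : Fin N, ∑ k : Fin 3,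
        ‖fderiv ℝ (fun Y : Config N => F Y * Ψ.ψ Y) X
          (Pi.single i (EuclideanSpace.single k (1 : ℝ)))‖ ^ 2) +
        (periodicInteraction v L X).toReal * ‖F X * Ψ.ψ X‖ ^ 2)) -
      E * (∫ X in cellN N L, ‖F X * Ψ.ψ X‖ ^ 2) =
    ∫ X in cellN N L, (∑ i : Fin N, ∑ k : Fin 3,
      ‖fderiv ℝ F X (Pi.single i (EuclideanSpace.single k (1 : ℝ)))‖ ^ 2) * ‖Ψ.ψ X‖ ^ 2 := by
  -- adapted from `ImuGroundStateRepresentation.form_modulated_sub_eq`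
  have hFd := hF.differentiable one_ne_zero
  have hΨd := Ψ.contDiff.differentiable one_ne_zero
  -- the test function `η = conj(F) (F Ψ)` and the derivatives of `F Ψ` and `η`
  have hconj : ∀ X, HasFDerivAt (fun Y => conj (F Y))
      ((Complex.conjCLE : ℂ →L[ℝ] ℂ).comp (fderiv ℝ F X)) X :=
    fun X => Complex.conjCLE.hasFDerivAt.comp X (hFd X).hasFDerivAt
  have hη : ContDiff ℝ 1 (fun Y => conj (F Y) * (F Y * Ψ.ψ Y)) :=
    (Complex.conjCLE.contDiff.comp hF).mul (hF.mul Ψ.contDiff)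
  have hDΦ : ∀ X w, fderiv ℝ (fun Y => F Y * Ψ.ψ Y) X w =
      F X * fderiv ℝ Ψ.ψ X w + Ψ.ψ X * fderiv ℝ F X w := fun X w => by
    rw [fderiv_fun_mul (hFd X) (hΨd X), add_apply, smul_apply, smul_apply, smul_eq_mul, smul_eq_mul]
  have hDη : ∀ X w, fderiv ℝ (fun Y => conj (F Y) * (F Y * Ψ.ψ Y)) X w =
      conj (F X) * (F X * fderiv ℝ Ψ.ψ X w + Ψ.ψ X * fderiv ℝ F X w) +
        F X * Ψ.ψ X * conj (fderiv ℝ F X w) := fun X w => by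
    rw [fderiv_fun_mul (hconj X).differentiableAt ((hFd X).fun_mul (hΨd X)), (hconj X).fderiv,
      add_apply, smul_apply, smul_apply, smul_eq_mul, smul_eq_mul, hDΦ X w,
      ContinuousLinearMap.comp_apply]
    rfl
  -- pointwise identity of the integrands
  have him : ∀ X, (Ψ.ψ X).im = 0 := fun X => by
    rw [hreal X]
    exact Complex.ofReal_im _
  have hpt : ∀ X, (∑ i : Fin N, ∑ k : Fin 3,
        ‖fderiv ℝ (fun Y : Config N => F Y * Ψ.ψ Y) X
          (Pi.single i (EuclideanSpace.single k (1 : ℝ)))‖ ^ 2) +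
        (periodicInteraction v L X).toReal * ‖F X * Ψ.ψ X‖ ^ 2 =
      (∑ i : Fin N, ∑ k : Fin 3,
          ‖fderiv ℝ F X (Pi.single i (EuclideanSpace.single k (1 : ℝ)))‖ ^ 2) * ‖Ψ.ψ X‖ ^ 2 +
        ((∑ i : Fin N, ∑ k : Fin 3,
            (conj (fderiv ℝ (fun Y => conj (F Y) * (F Y * Ψ.ψ Y)) X
                (Pi.single i (EuclideanSpace.single k (1 : ℝ)))) *
              fderiv ℝ Ψ.ψ X (Pi.single i (EuclideanSpace.single k (1 : ℝ)))).re) +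
          (periodicInteraction v L X).toReal * (conj (conj (F X) * (F X * Ψ.ψ X)) * Ψ.ψ X).re) := by
    intro X
    have hterm : ∀ (i : Fin N) (k : Fin 3),
        ‖fderiv ℝ (fun Y : Config N => F Y * Ψ.ψ Y) X
            (Pi.single i (EuclideanSpace.single k (1 : ℝ)))‖ ^ 2 =
          ‖fderiv ℝ F X (Pi.single i (EuclideanSpace.single k (1 : ℝ)))‖ ^ 2 * ‖Ψ.ψ X‖ ^ 2 +
            (conj (fderiv ℝ (fun Y => conj (F Y) * (F Y * Ψ.ψ Y)) X
                (Pi.single i (EuclideanSpace.single k (1 : ℝ)))) *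
              fderiv ℝ Ψ.ψ X (Pi.single i (EuclideanSpace.single k (1 : ℝ)))).re := fun i k => by
      rw [hDΦ, hDη]
      exact norm_sq_modulatedDeriv _ _ _ _ (him X) (im_fderiv_eq_zero Ψ hreal X _)
    simp only [hterm, Finset.sum_add_distrib, Finset.sum_mul, re_conj_modulatedTest_mul]
    ring
  have hmass : ∀ X, (conj (conj (F X) * (F X * Ψ.ψ X)) * Ψ.ψ X).re = ‖F X * Ψ.ψ X‖ ^ 2 :=
    fun X => re_conj_modulatedTest_mul _ _
  -- integrability on the bounded cell
  have h1 := hF.continuous_fderiv one_ne_zero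
  have h2 := Ψ.contDiff.continuous_fderiv one_ne_zero
  have h3 := hη.continuous_fderiv one_ne_zero
  have hFc := hF.continuous
  have hΨc := Ψ.contDiff.continuous
  have iA : IntegrableOn (fun X => (∑ i : Fin N, ∑ k : Fin 3,
      ‖fderiv ℝ F X (Pi.single i (EuclideanSpace.single k (1 : ℝ)))‖ ^ 2) * ‖Ψ.ψ X‖ ^ 2)
      (cellN N L) :=
    integrableOn_cellN (by fun_prop) L
  have iB : IntegrableOn (fun X => (∑ i : Fin N, ∑ k : Fin 3,
      (conj (fderiv ℝ (fun Y => conj (F Y) * (F Y * Ψ.ψ Y)) X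
          (Pi.single i (EuclideanSpace.single k (1 : ℝ)))) *
        fderiv ℝ Ψ.ψ X (Pi.single i (EuclideanSpace.single k (1 : ℝ)))).re) +
      (periodicInteraction v L X).toReal * (conj (conj (F X) * (F X * Ψ.ψ X)) * Ψ.ψ X).re)
      (cellN N L) :=
    (integrableOn_cellN (by fun_prop) L).add
      (integrableOn_toReal_interaction_mul' hvm hW (by fun_prop))
  have hsplit : (∫ X in cellN N L, ((∑ i : Fin N, ∑ k : Fin 3,
      ‖fderiv ℝ (fun Y : Config N => F Y * Ψ.ψ Y) X
        (Pi.single i (EuclideanSpace.single k (1 : ℝ)))‖ ^ 2) +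
      (periodicInteraction v L X).toReal * ‖F X * Ψ.ψ X‖ ^ 2)) =
      (∫ X in cellN N L, (∑ i : Fin N, ∑ k : Fin 3,
        ‖fderiv ℝ F X (Pi.single i (EuclideanSpace.single k (1 : ℝ)))‖ ^ 2) * ‖Ψ.ψ X‖ ^ 2) +
      ∫ X in cellN N L, ((∑ i : Fin N, ∑ k : Fin 3,
            (conj (fderiv ℝ (fun Y => conj (F Y) * (F Y * Ψ.ψ Y)) X
                (Pi.single i (EuclideanSpace.single k (1 : ℝ)))) *
              fderiv ℝ Ψ.ψ X (Pi.single i (EuclideanSpace.single k (1 : ℝ)))).re) +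
          (periodicInteraction v L X).toReal * (conj (conj (F X) * (F X * Ψ.ψ X)) * Ψ.ψ X).re) := by
    rw [← integral_add iA iB]
    exact integral_congr_ae (ae_of_all _ hpt)
  have hM : (∫ X in cellN N L, (conj (conj (F X) * (F X * Ψ.ψ X)) * Ψ.ψ X).re) =
      ∫ X in cellN N L, ‖F X * Ψ.ψ X‖ ^ 2 :=
    integral_congr_ae (ae_of_all _ hmass)
  rw [hsplit, hEL, hM]
  ring

/-- **Ground-state representation (modulation form)** under an interaction integrable on the
cell: for a non-negative real-valued periodic minimiser `Ψ` (`Ψ = |Ψ|`) with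
`periodicEnergy v Ψ = E₀ < ∞` and every `C¹`, `Lℤ³`-periodic, Bose-symmetric modulation `F`,
`∫ (|∇(FΨ)|² + W|FΨ|²) - E₀ ∫ |FΨ|² = ∫ |∇F|² |Ψ|²`. [cite: LSSY2005, (6.26)–(6.28)] -/
theorem groundStateRepresentation' (hvm : Measurable v)
    (hW : ∫⁻ X in cellN N L, periodicInteraction v L X ≠ ⊤) (Ψ : PeriodicTrialState N L)
    (hmin : periodicEnergy v Ψ = periodicGroundStateEnergy v N L) (hfin : periodicEnergy v Ψ ≠ ⊤)
    (hreal : ∀ X, Ψ.ψ X = (‖Ψ.ψ X‖ : ℂ)) {F : Config N → ℂ} (hF : ContDiff ℝ 1 F)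
    (hFper : ∀ (X : Config N) (i : Fin N) (k : Fin 3),
      F (X + Pi.single i (EuclideanSpace.single k L)) = F X)
    (hFsymm : ∀ (σ : Equiv.Perm (Fin N)) (X : Config N), F (X ∘ σ) = F X) :
    (∫ X in cellN N L, ((∑ i : Fin N, ∑ k : Fin 3,
        ‖fderiv ℝ (fun Y : Config N => F Y * Ψ.ψ Y) X
          (Pi.single i (EuclideanSpace.single k (1 : ℝ)))‖ ^ 2) +
        (periodicInteraction v L X).toReal * ‖F X * Ψ.ψ X‖ ^ 2)) -
      (periodicGroundStateEnergy v N L).toReal * (∫ X in cellN N L, ‖F X * Ψ.ψ X‖ ^ 2) =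
    ∫ X in cellN N L, (∑ i : Fin N, ∑ k : Fin 3,
      ‖fderiv ℝ F X (Pi.single i (EuclideanSpace.single k (1 : ℝ)))‖ ^ 2) * ‖Ψ.ψ X‖ ^ 2 := by
  have hη : ContDiff ℝ 1 (fun Y : Config N => conj (F Y) * (F Y * Ψ.ψ Y)) :=
    (Complex.conjCLE.contDiff.comp hF).mul (hF.mul Ψ.contDiff)
  have hηper : ∀ (X : Config N) (i : Fin N) (k : Fin 3),
      (fun Y : Config N => conj (F Y) * (F Y * Ψ.ψ Y))
          (X + Pi.single i (EuclideanSpace.single k L)) =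
        (fun Y : Config N => conj (F Y) * (F Y * Ψ.ψ Y)) X := fun X i k => by
    simp only [hFper, Ψ.periodic]
  have hηsymm : ∀ (σ : Equiv.Perm (Fin N)) (X : Config N),
      (fun Y : Config N => conj (F Y) * (F Y * Ψ.ψ Y)) (X ∘ σ) =
        (fun Y : Config N => conj (F Y) * (F Y * Ψ.ψ Y)) X := fun σ X => by
    simp only [hFsymm, Ψ.symm]
  have hEL := firstVariation_eq' hvm hW Ψ hmin hfin hη hηper hηsymm
  exact form_modulated_sub_eq' hvm hW Ψ hreal hF _ hEL

/-! ### The identity over `relativeFisherInformation` -/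

/-- The relative Fisher information of two real `C¹` amplitudes with `Ψ_Q` non-vanishing, in real
form on the cell: `I_{cell}(P‖Q) = ofReal (4 ∫_{cell} (∑_{i,k} |∂_{i,k}(Ψ_P/Ψ_Q)|²) Ψ_Q²)`.
[cite: RezakhanlouVillani2008, Part I §1.3.1 p. 15] -/
theorem relativeFisherInformation_eq_ofReal_integral {ΨP ΨQ : Config N → ℝ} (hP : ContDiff ℝ 1 ΨP)
    (hQ : ContDiff ℝ 1 ΨQ) (hQ0 : ∀ X, ΨQ X ≠ 0) (L : ℝ) :
    relativeFisherInformation (cellN N L) ΨP ΨQ =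
      ENNReal.ofReal (4 * ∫ X in cellN N L, (∑ i : Fin N, ∑ k : Fin 3,
        ‖fderiv ℝ (fun Y => ΨP Y / ΨQ Y) X (Pi.single i (EuclideanSpace.single k (1 : ℝ)))‖ ^ 2) *
          ΨQ X ^ 2) := by
  have hh : ContDiff ℝ 1 (fun Y => ΨP Y / ΨQ Y) := hP.div hQ hQ0
  have hc : Continuous fun X => (∑ i : Fin N, ∑ k : Fin 3,
      ‖fderiv ℝ (fun Y => ΨP Y / ΨQ Y) X (Pi.single i (EuclideanSpace.single k (1 : ℝ)))‖ ^ 2) *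
        ΨQ X ^ 2 := by
    have h1 := hh.continuous_fderiv one_ne_zero
    have h2 := hQ.continuous
    fun_prop
  have hnn : ∀ X, 0 ≤ (∑ i : Fin N, ∑ k : Fin 3,
      ‖fderiv ℝ (fun Y => ΨP Y / ΨQ Y) X (Pi.single i (EuclideanSpace.single k (1 : ℝ)))‖ ^ 2) *
        ΨQ X ^ 2 := fun X =>
    mul_nonneg (Finset.sum_nonneg fun _ _ => Finset.sum_nonneg fun _ _ => sq_nonneg _) (sq_nonneg _)
  rw [relativeFisherInformation_eq_four_mul_lintegral, ENNReal.ofReal_mul zero_le_four,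
    ENNReal.ofReal_ofNat, ofReal_integral_eq_lintegral_ofReal (integrableOn_cellN hc L)
      (ae_of_all _ hnn)]
  congr 1
  refine lintegral_congr fun X => ?_
  rw [ENNReal.ofReal_mul (Finset.sum_nonneg fun _ _ => Finset.sum_nonneg fun _ _ => sq_nonneg _),
    ENNReal.ofReal_sum_of_nonneg (fun _ _ => Finset.sum_nonneg fun _ _ => sq_nonneg _)]
  congr 1
  refine Finset.sum_congr rfl fun i _ => ?_
  rw [ENNReal.ofReal_sum_of_nonneg (fun _ _ => sq_nonneg _)]
  refine Finset.sum_congr rfl fun k _ => ?_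
  exact coe_nnnorm_sq_eq_ofReal
    (fderiv ℝ (fun Y => ΨP Y / ΨQ Y) X (Pi.single i (EuclideanSpace.single k (1 : ℝ))))

/-- **Ground-state representation over `relativeFisherInformation`** (the identity of item
`GroundStateRepresentation` of route `BECFisherTransfer`, under the finiteness guard `E₀^per < ∞`):
for any measurable `v ≥ 0`, an exact real positive `C¹` periodic minimiser `Ψ₀` with
`periodicEnergy v Ψ₀ = E₀^per < ∞`, and any real periodic trial state `Φ`,
`periodicEnergy v Φ = E₀^per + ¼ I_{cell^N}(P_Φ ‖ P_Ψ₀)`. Proof: `Ψ₀ ≥ m > 0` on the cell makes the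
interaction integrable there (`lintegral_interaction_ne_top`); apply the modulation form
`groundStateRepresentation'` with `F = Φ/Ψ₀` (so `FΨ₀ = Φ`), and identify `∫ |∇F|² Ψ₀²` with
`¼ I` (`relativeFisherInformation_eq_ofReal_integral`, the derivative of the complexified ratio
having the same size as that of the real one). [cite: LSSY2005, (6.26)–(6.28)] -/
theorem periodicEnergy_eq_add_relativeFisherInformation (hvm : Measurable v)
    (Ψ₀ Φ : PeriodicTrialState N L)
    (hmin : periodicEnergy v Ψ₀ = periodicGroundStateEnergy v N L)
    (hfin : periodicEnergy v Ψ₀ ≠ ⊤)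
    (hpos : ∀ X, Ψ₀.ψ X = ((Ψ₀.ψ X).re : ℂ) ∧ 0 < (Ψ₀.ψ X).re)
    (hΦ : ∀ X, Φ.ψ X = ((Φ.ψ X).re : ℂ)) :
    periodicEnergy v Φ = periodicGroundStateEnergy v N L +
      4⁻¹ * relativeFisherInformation (cellN N L) (fun X => (Φ.ψ X).re) (fun X => (Ψ₀.ψ X).re) := by
  -- notation and basic facts
  set ψr : Config N → ℝ := fun X => (Ψ₀.ψ X).re with hψr
  set φr : Config N → ℝ := fun X => (Φ.ψ X).re with hφr
  have hψrC : ContDiff ℝ 1 ψr := Complex.reCLM.contDiff.comp Ψ₀.contDiff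
  have hφrC : ContDiff ℝ 1 φr := Complex.reCLM.contDiff.comp Φ.contDiff
  have hψr0 : ∀ X, ψr X ≠ 0 := fun X => (hpos X).2.ne'
  have hΨ0 : ∀ X, Ψ₀.ψ X ≠ 0 := fun X h => by
    have := (hpos X).2
    rw [h, Complex.zero_re] at this
    exact lt_irrefl _ this
  have hnorm : ∀ X, ‖Ψ₀.ψ X‖ = ψr X := fun X => by
    rw [(hpos X).1, Complex.norm_real, Real.norm_of_nonneg (hpos X).2.le]
  have hreal : ∀ X, Ψ₀.ψ X = (‖Ψ₀.ψ X‖ : ℂ) := fun X => by rw [hnorm X]; exact (hpos X).1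
  -- a positive floor on the cell, hence an integrable interaction
  obtain ⟨m, hm, hmle⟩ := exists_pos_le_on_cellN hψrC.continuous (fun X => (hpos X).2) L
  have hW : ∫⁻ X in cellN N L, periodicInteraction v L X ≠ ⊤ :=
    lintegral_interaction_ne_top hvm Ψ₀ hfin hm fun X hX => (hnorm X).symm ▸ hmle X hX
  have hE : periodicGroundStateEnergy v N L ≠ ⊤ := hmin ▸ hfin
  -- the modulation `F = Φ/Ψ₀`
  set F : Config N → ℂ := fun Y => Φ.ψ Y * (Ψ₀.ψ Y)⁻¹ with hFdef
  have hF : ContDiff ℝ 1 F := Φ.contDiff.mul (Ψ₀.contDiff.inv hΨ0)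
  have hFper : ∀ (X : Config N) (i : Fin N) (k : Fin 3),
      F (X + Pi.single i (EuclideanSpace.single k L)) = F X := fun X i k => by
    simp only [hFdef, Φ.periodic, Ψ₀.periodic]
  have hFsymm : ∀ (σ : Equiv.Perm (Fin N)) (X : Config N), F (X ∘ σ) = F X := fun σ X => by
    simp only [hFdef, Φ.symm, Ψ₀.symm]
  have hFΨ' : ∀ Y, F Y * Ψ₀.ψ Y = Φ.ψ Y := fun Y => inv_mul_cancel_right₀ (hΨ0 Y) _
  have hFΨ : (fun Y : Config N => F Y * Ψ₀.ψ Y) = Φ.ψ := funext hFΨ'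
  have hFratio : F = fun Y => ((φr Y / ψr Y : ℝ) : ℂ) := funext fun Y => by
    simp only [hFdef, hφr, hψr]
    rw [Complex.ofReal_div, ← (hpos Y).1, ← hΦ Y, div_eq_mul_inv]
  -- the ground-state representation in modulation form
  have hGSR := groundStateRepresentation' hvm hW Ψ₀ hmin hfin hreal hF hFper hFsymm
  rw [hFΨ] at hGSR
  simp only [hFΨ'] at hGSR
  -- identify the pieces
  have hkin : ∀ X, (∑ i : Fin N, ∑ k : Fin 3,
      ‖fderiv ℝ Φ.ψ X (Pi.single i (EuclideanSpace.single k (1 : ℝ)))‖ ^ 2) =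
        kineticDensityReal Φ.ψ X := fun X => rfl
  simp_rw [hkin] at hGSR
  have hEΦ : periodicEnergy v Φ = ENNReal.ofReal (∫ X in cellN N L, (kineticDensityReal Φ.ψ X +
      (periodicInteraction v L X).toReal * ‖Φ.ψ X‖ ^ 2)) :=
    periodicForm_eq_ofReal' hvm hW Φ.contDiff
  have hMΦ : ∫ X in cellN N L, ‖Φ.ψ X‖ ^ 2 = 1 := by
    have h1 := lintegral_nnnorm_sq_eq_ofReal Φ.contDiff.continuous L
    rw [Φ.norm_eq] at h1
    rw [← ENNReal.toReal_ofReal (integral_nonneg fun X => sq_nonneg ‖Φ.ψ X‖), ← h1,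
      ENNReal.toReal_one]
  have hRHS : (∫ X in cellN N L, (∑ i : Fin N, ∑ k : Fin 3,
      ‖fderiv ℝ F X (Pi.single i (EuclideanSpace.single k (1 : ℝ)))‖ ^ 2) * ‖Ψ₀.ψ X‖ ^ 2) =
      ∫ X in cellN N L, (∑ i : Fin N, ∑ k : Fin 3,
        ‖fderiv ℝ (fun Y => φr Y / ψr Y) X (Pi.single i (EuclideanSpace.single k (1 : ℝ)))‖ ^ 2) *
          ψr X ^ 2 := by
    refine integral_congr_ae (ae_of_all _ fun X => ?_)
    simp only [hFratio, hnorm]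
    congr 1
    refine Finset.sum_congr rfl fun i _ => Finset.sum_congr rfl fun k _ => ?_
    have h := nnnorm_fderiv_ofReal_comp_apply (fun Y => φr Y / ψr Y) X
      (Pi.single i (EuclideanSpace.single k (1 : ℝ)))
    have h' := congrArg (fun r : ℝ≥0 => (r : ℝ)) h
    simp only [coe_nnnorm] at h'
    rw [h']
  rw [hMΦ, mul_one, hRHS] at hGSR
  set R : ℝ := ∫ X in cellN N L, (∑ i : Fin N, ∑ k : Fin 3,
      ‖fderiv ℝ (fun Y => φr Y / ψr Y) X (Pi.single i (EuclideanSpace.single k (1 : ℝ)))‖ ^ 2) *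
        ψr X ^ 2 with hR
  have hR0 : 0 ≤ R := integral_nonneg fun X =>
    mul_nonneg (Finset.sum_nonneg fun _ _ => Finset.sum_nonneg fun _ _ => sq_nonneg _) (sq_nonneg _)
  have hI : relativeFisherInformation (cellN N L) φr ψr = ENNReal.ofReal (4 * R) :=
    relativeFisherInformation_eq_ofReal_integral hφrC hψrC hψr0 L
  have hInn : 0 ≤ ∫ X in cellN N L, (kineticDensityReal Φ.ψ X +
      (periodicInteraction v L X).toReal * ‖Φ.ψ X‖ ^ 2) := integral_nonneg fun X =>
    add_nonneg (kineticDensityReal_nonneg _ X) (mul_nonneg ENNReal.toReal_nonneg (sq_nonneg _))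
  -- assemble in `ℝ≥0∞`
  have hsum : (∫ X in cellN N L, (kineticDensityReal Φ.ψ X +
      (periodicInteraction v L X).toReal * ‖Φ.ψ X‖ ^ 2)) =
      (periodicGroundStateEnergy v N L).toReal + R := by linarith
  rw [hEΦ, hsum, hI, ENNReal.ofReal_add ENNReal.toReal_nonneg hR0, ENNReal.ofReal_toReal hE,
    ENNReal.ofReal_mul zero_le_four, ENNReal.ofReal_ofNat, ← mul_assoc,
    ENNReal.inv_mul_cancel (by norm_num) (by norm_num), one_mul]

end TrialDriftFisher

end Summit.AtomisticToContinuum.BoseEinsteinCondensation.Theorems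

end
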